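import Literature.MathematicalPhysics.QuantumLattice.HeisenbergOrderDLSProofs
import Literature.MathematicalPhysics.QuantumLattice.HeisenbergOrderNeelRiemann3
import HarnessLib

/-!
# Néel order at low temperature for the spin-½ Heisenberg antiferromagnet in three dimensions
# (Kennedy–Lieb–Shastry 1988, remark p. 1020, closing the `S = ½, ν = 3` case left open in
# Dyson–Lieb–Simon 1978, Theorem 6.2)

Sibling proof file of `HeisenbergOrder.lean` / `HeisenbergOrderDLSProofs.lean`. No named fact is
introduced; everything here is a theorem (trust base: Mathlib's three standard axioms).

## What is printed

* Dyson–Lieb–Simon, J. Stat. Phys. **18** (1978) 335–383, Theorem 6.2 (p. 364): "The nearest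
  neighbor, simple cubic antiferromagnet has a phase transition at sufficiently low temperature if
  `ν ≥ 3`, `S = 1, 3/2, …` or if `S = 1/2` and `ν` is sufficiently large."  Immediately before it
  (same page): "Thus for (62) to hold with `S = 1/2`, `ν = 3` one needs that `ρ₃ < 0.28`. The best
  rigorous bounds [from (64) and the trivial `ρ_ν ≥ S²`] are `0.25 < ρ₃ < 0.33`. … there is a need
  for better rigorous bounds to be certain that (62) fails for `ν = 3`, `S = 1/2`".  So the
  positive-temperature case `S = ½`, `ν = 3` is NOT covered by [DLS1978] (tree: `dyson_lieb_simon`,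
  hypothesis `2 ≤ n`, i.e. `S ≥ 1`).
* Kennedy–Lieb–Shastry, J. Stat. Phys. **53** (1988) 1019–1030, p. 1020: "In this paper we show
  that a simple extension of the above methods proves the existence of Néel order for the case of
  spin 1/2 in three dimensions. We also consider a spin-1/2 model which interpolates between two and
  three dimensions … For this model we prove that there is Néel order if `1 ≥ r ≥ 0.16`. (Although
  we only consider the ground states of these models, the techniques we use may be combined with the
  techniques of Dyson et al. for nonzero temperatures to prove the existence of a phase transition
  for `1 ≥ r ≥ 0.16`.)"  The isotropic cubic lattice is `r = 1`.

This file carries out exactly that combination, in finite volume on the even tori `(ℤ/2kℤ)^d`: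
the Dyson–Lieb–Simon positive-temperature route **as already formalised in the KLS arrangement**
in `HeisenbergOrderDLSProofs.lean` — reflection positivity ⇒ thermal Gaussian domination ⇒ the
infrared bound for the Duhamel function and the Falk–Bruch transfer (`dls_infraredBound`), the
sum rule split at `q = 0` with the positive part `(d⁻¹Σᵢcos qᵢ)₊` of [KLS1988JSP] eq. (4)
(`dls_ineq`: `ε ≤ |Λ|⁻¹ĝ₀ + ½√(2ε) R_L + T_L/(2βJ)`), the `SU(2)` symmetry and the Néel-state
energy–entropy bound (`gibbsBondCorr_dls_eq`, `dls_bondCorr_energy_bound`: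
`3ε ≥ S² - log(n+1)/(dβJ)`) — combined with the KLS numerical input for `d = 3`, the certified
eventual bound on the punctured Riemann sums of the KLS integrand
`klsRiemannSum_three_eventually_le : ∃ ρ < 1/√6, ∀ᶠ L, R_L(3) ≤ ρ`
(`HeisenbergOrderNeelRiemann3.lean`; KLS p. 1022: the integral is `0.35·…`, threshold `2S/√6`).
`dyson_lieb_simon_holds` used instead the crude all-`d` bound `limsup R_L < 1/√2`
(`klsRiemannSum_eventually_le`), which is why it needs `S ≥ 1` (`S²/3 > ¼ ≥ R²/2`).

## The theorems

* `heis_thermalNeelOrder_of_riemannSum` — the positive-temperature KLS criterion, every `d ≥ 3`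
  and spin `S = n/2 ≥ ½`: if `R_L(d) ≤ ρ < 2S/√6 = n/√6` for all large `L`, then for every `J > 0`
  there is `β₀ > 0` such that for all `β ≥ β₀` the Gibbs states of `J Σ 𝐒_x·𝐒_y` on the even tori
  have Néel long-range order (`HasStaggeredEvenTorusLRO` of `spinSpinCorrTorus β`, the vocabulary
  of `dyson_lieb_simon`).  Quantitatively: with `m₁ = S²/3 - ½√(S²/3)·√2ρ > 0` and `βJ` so large
  that `log(n+1)/(3dβJ) ≤ m₁/6` and `T_L/(2βJ) ≤ m₁/4` eventually, the order parameter is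
  eventually `≥ 3m₁/2`.  (The same threshold `2S/√6` as the ground-state criterion
  `heis_neelOrder_of_infraredBound`; the dimension enters only through `T_L < ∞`, `d ≥ 3`.)
* `kennedy_lieb_shastry_thermal_three` — `d = 3`, every `S ≥ ½`: Néel order at low temperature,
  from the certified `klsRiemannSum_three_eventually_le`.
* `heisenbergAF_spinHalf_cubic_thermalNeelOrder` — the headline case `S = ½` (`n = 1`), `d = 3`.

`TODO(general form)`: [DLS1978] Thm. 6.2's clause "`S = 1/2` and `ν` sufficiently large" and the
cases `d ≥ 4`, `S = ½` need certified bounds on `R_L(d)` for `d ≥ 4` (not in the tree); the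
anisotropic `r`-model of [KLS1988JSP] §3 (`0.16 ≤ r < 1`) is not formalised.

## References

* [KLS1988JSP] T. Kennedy, E. H. Lieb, B. S. Shastry, *Existence of Néel order in some spin-1/2
  Heisenberg antiferromagnets*, J. Stat. Phys. 53 (1988) 1019–1030 — p. 1020 (the remark quoted
  above), eqs. (1)–(4), Theorem p. 1022 (read in: E. H. Lieb, *Statistical Mechanics (Selecta)*,
  Springer 2004, paper IV.7).
* [DLS1978] F. J. Dyson, E. H. Lieb, B. Simon, *Phase transitions in quantum spin systems with
  isotropic and nonisotropic interactions*, J. Stat. Phys. 18 (1978) 335–383, Thm. 6.2 and the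
  paragraph preceding it (Selecta paper IV.3).
* [Tasaki2019Tower] H. Tasaki, J. Stat. Phys. 174 (2019) 735–761, §3.2 (survey of what is proved).
-/

noncomputable section

open Filter Topology Matrix Finset
open Literature.MathematicalPhysics.QuantumLattice Literature.Probability.LatticeModels
  Literature.Barriers.AtomisticToContinuum.BoseGas
open scoped ComplexOrder

namespace Literature.MathematicalPhysics.QuantumLattice

variable {d : ℕ}

/-- **The margin at spin `S = n/2`.** If `ρ < n/√6 = 2S/√6` (`n ≥ 1`) then
`m₁ = S²/3 - ½ √(S²/3) (√2 ρ) > 0`: indeed `√(S²/3)·√2 = S√6/3`, so `m₁ = (S/6)(2S - √6 ρ)`.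
This is the number `3u₀(2u₀ - ρ)/6`, `u₀ = S/√6`, of the ground-state criterion
`heis_neelOrder_of_infraredBound`. [cite: KLS1988JSP, p. 1022 (Theorem: "(4) implies that e₀ ≤ 0.550 … there must be Néel order when d = 3 and S = 1/2")] -/
theorem heis_thermal_margin_pos {n : ℕ} (hn : 1 ≤ n) {ρ : ℝ} (hρ : ρ < n / Real.sqrt 6) :
    0 < ((n : ℝ) / 2) ^ 2 / 3 -
      1 / 2 * Real.sqrt (((n : ℝ) / 2) ^ 2 / 3) * (Real.sqrt 2 * ρ) := by
  have hn0 : (0 : ℝ) < n := by exact_mod_cast (show 0 < n by omega)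
  have h6 : 0 < Real.sqrt 6 := Real.sqrt_pos.2 (by norm_num)
  have hρ' : Real.sqrt 6 * ρ < n := by
    rw [lt_div_iff₀ h6] at hρ
    linarith [mul_comm ρ (Real.sqrt 6)]
  have hS0 : (0 : ℝ) ≤ (n : ℝ) / 2 := by positivity
  have hsq : Real.sqrt (((n : ℝ) / 2) ^ 2 / 3) * Real.sqrt 2 = (n : ℝ) / 2 * Real.sqrt 6 / 3 := by
    have h6sq : Real.sqrt 6 ^ 2 = 6 := Real.sq_sqrt (by norm_num)
    rw [← Real.sqrt_mul (by positivity),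
      show ((n : ℝ) / 2) ^ 2 / 3 * 2 = ((n : ℝ) / 2 * Real.sqrt 6 / 3) ^ 2 by
        rw [show ((n : ℝ) / 2 * Real.sqrt 6 / 3) ^ 2 = ((n : ℝ) / 2) ^ 2 * Real.sqrt 6 ^ 2 / 9 by
          ring, h6sq]; ring]
    exact Real.sqrt_sq (by positivity)
  have hrw : 1 / 2 * Real.sqrt (((n : ℝ) / 2) ^ 2 / 3) * (Real.sqrt 2 * ρ) =
      (n : ℝ) / 2 * (Real.sqrt 6 * ρ) / 6 := by
    rw [show 1 / 2 * Real.sqrt (((n : ℝ) / 2) ^ 2 / 3) * (Real.sqrt 2 * ρ) =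
      1 / 2 * (Real.sqrt (((n : ℝ) / 2) ^ 2 / 3) * Real.sqrt 2) * ρ by ring, hsq]
    ring
  rw [hrw]
  nlinarith [mul_lt_mul_of_pos_left hρ' (half_pos hn0)]

/-- **Kennedy–Lieb–Shastry's positive-temperature criterion (their remark p. 1020 made
quantitative; the Dyson–Lieb–Simon route in the KLS arrangement).** For `d ≥ 3` and spin
`S = n/2 ≥ ½`: if the punctured Riemann sums of the KLS integrand satisfy `R_L(d) ≤ ρ` for all large
`L` with `ρ < 2S/√6 = n/√6`, then for every `J > 0` there is `β₀ > 0` such that for all `β ≥ β₀`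
the Gibbs states of the Heisenberg antiferromagnet `J Σ_{⟨xy⟩} 𝐒_x·𝐒_y` on the even tori
`(ℤ/2kℤ)^d` have Néel long-range order,
`liminf_k |Λ|⁻² Σ_{x,y} (-1)^{x+y} ⟨𝐒_x·𝐒_y⟩_{β,2k} > 0` (`HasStaggeredEvenTorusLRO`).
Proof: `dls_ineq` (`ε ≤ |Λ|⁻¹ĝ₀ + ½√(2ε)R_L + T_L/(2βJ)`), `dls_bondCorr_energy_bound`
(`3ε ≥ S² - log(n+1)/(dβJ)`), the monotonicity of `t ↦ t - ½√t·(√2R)` (`kls_monotone_step`),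
`T_L ≤ 𝒯` eventually for `d ≥ 3` (`torusGreen_zero_eventually_le`) and the margin
`heis_thermal_margin_pos`; eventually in `L = 2k` the order parameter is `≥ 3m₁/2`.
[cite: KLS1988JSP, p. 1020 (remark "the techniques we use may be combined with the techniques of Dyson et al. for nonzero temperatures") and eqs. (1)–(4)]
[cite: DLS1978, Thm. 6.2 and §6] -/
theorem heis_thermalNeelOrder_of_riemannSum (hd : 3 ≤ d) {n : ℕ} (hn : 1 ≤ n)
    (hρ : ∃ ρ : ℝ, ρ < n / Real.sqrt 6 ∧ ∀ᶠ L : ℕ in atTop, klsRiemannSum d L ≤ ρ)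
    {J : ℝ} (hJ : 0 < J) :
    ∃ β₀ : ℝ, 0 < β₀ ∧ ∀ β : ℝ, β₀ ≤ β →
      HasStaggeredEvenTorusLRO (fun L x y => spinSpinCorrTorus (d := d) β L n J x y) := by
  have hd1 : 1 ≤ d := by omega
  have hd0 : (0 : ℝ) < d := by exact_mod_cast (show 0 < d by omega)
  have hn0 : (0 : ℝ) < n := by exact_mod_cast (show 0 < n by omega)
  have h6 : 0 < Real.sqrt 6 := Real.sqrt_pos.2 (by norm_num)
  -- the eventual bound on the KLS Riemann sums
  obtain ⟨ρ, hρlt, hρev⟩ := hρ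
  set ρ' : ℝ := max ρ 0 with hρ'_def
  have hρ'0 : 0 ≤ ρ' := le_max_right _ _
  have hρ'lt : ρ' < n / Real.sqrt 6 := max_lt hρlt (by positivity)
  have hρ'n : Real.sqrt 6 * ρ' < n := by
    have h := hρ'lt
    rw [lt_div_iff₀ h6] at h
    linarith [mul_comm ρ' (Real.sqrt 6)]
  -- the spin
  set S : ℝ := (n : ℝ) / 2 with hS_def
  have hS0 : 0 < S := by positivity
  -- the margin
  set m₁ : ℝ := S ^ 2 / 3 - 1 / 2 * Real.sqrt (S ^ 2 / 3) * (Real.sqrt 2 * ρ') with hm₁_def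
  have hm₁ : 0 < m₁ := heis_thermal_margin_pos hn hρ'lt
  have hm₁le : m₁ ≤ S ^ 2 / 3 := by
    have : 0 ≤ 1 / 2 * Real.sqrt (S ^ 2 / 3) * (Real.sqrt 2 * ρ') := by positivity
    linarith
  -- the thermal term `T_L`
  obtain ⟨𝒯, k₀, h𝒯0, h𝒯⟩ := torusGreen_zero_eventually_le (d := d) hd
  -- the threshold `β₀`
  set ℓ : ℝ := Real.log (n + 1) / d with hℓ_def
  have hℓ0 : 0 ≤ ℓ := by
    rw [hℓ_def]
    exact div_nonneg (Real.log_nonneg (by norm_cast; omega)) hd0.le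
  set β₀ : ℝ := (2 * ℓ + 2 * 𝒯 + 1) / (m₁ * J) with hβ₀_def
  have hβ₀pos : 0 < β₀ := by rw [hβ₀_def]; positivity
  refine ⟨β₀, hβ₀pos, fun β hβ => ?_⟩
  have hβpos : 0 < β := hβ₀pos.trans_le hβ
  -- `β' = βJ`
  set β' : ℝ := β * J with hβ'_def
  have hβ'pos : 0 < β' := mul_pos hβpos hJ
  have hβ'ge : 2 * ℓ + 2 * 𝒯 + 1 ≤ m₁ * β' := by
    have h := (div_le_iff₀ (mul_pos hm₁ hJ)).1 hβ
    rw [hβ'_def]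
    linarith
  have hℓβ : ℓ / (3 * β') ≤ m₁ / 6 := by
    rw [div_le_iff₀ (by positivity)]
    linarith only [hβ'ge, h𝒯0]
  have h𝒯β : 𝒯 / (2 * β') ≤ m₁ / 4 := by
    rw [div_le_iff₀ (by positivity)]
    linarith only [hβ'ge, hℓ0]
  rw [HasStaggeredEvenTorusLRO, HasStaggeredLongRangeOrder, HasLongRangeOrder]
  -- eventually `R_{2k} ≤ ρ'`
  have h2k : Tendsto (fun k : ℕ => 2 * k) atTop atTop :=
    tendsto_atTop_atTop.2 fun b => ⟨b, fun k hk => by omega⟩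
  have hRk : ∀ᶠ k : ℕ in atTop, klsRiemannSum d (2 * k) ≤ ρ' :=
    (h2k.eventually hρev).mono fun k hk => hk.trans (le_max_left _ _)
  -- eventually the order parameter is `≥ 3 m₁ / 2`
  have hev : ∀ᶠ k : ℕ in atTop, 3 * (m₁ / 2) ≤
      (∑ x ∈ halfOpenBox d (2 * k), ∑ y ∈ halfOpenBox d (2 * k),
          latticeStagger x * latticeStagger y *
            torusPullback (fun L x y => spinSpinCorrTorus (d := d) β L n J x y) (2 * k) x y) /
        ((halfOpenBox d (2 * k)).card : ℝ) ^ 2 := by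
    filter_upwards [hRk, eventually_ge_atTop 2, eventually_ge_atTop k₀] with k hk hk2 hkk₀
    haveI : NeZero (2 * k) := ⟨by omega⟩
    rw [staggeredSum_torusPullback_of_neZero, dls_orderParameter_eq]
    set X := dlsHamiltonian d (2 * k) n with hX
    set e₀ := gibbsBondCorr β' X 0 with he₀
    set e₁ := gibbsBondCorr β' X 1 with he₁
    set e₂ := gibbsBondCorr β' X 2 with he₂
    set g₀ := gibbsStructureFactor β' X 0 (0 : TorusSite d (2 * k)) / ((2 * k : ℕ) : ℝ) ^ d
      with hg₀
    set R := klsRiemannSum d (2 * k) with hR_def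
    set T := torusGreen (0 : TorusSite d (2 * k)) with hT_def
    have hR0 : 0 ≤ R := klsRiemannSum_nonneg _ _
    have hT0 : 0 ≤ T := torusGreen_zero_nonneg (d := d) (2 * k)
    have hT𝒯 : T ≤ 𝒯 := h𝒯 k hkk₀ (by omega)
    -- (SYM): `e₀ = ε`, `e₁ = -ε`, `e₂ = ε`
    obtain ⟨hE0, hE1, hE2⟩ := gibbsBondCorr_dls_eq (d := d) β k n J
    rw [← hβ'_def, ← hX] at hE0 hE1 hE2
    set ε : ℝ := -gibbsBondCorr β (heisenbergTorus d (2 * k) n J) 0 with hε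
    have hε0 : e₀ = ε := by rw [he₀, hE0]
    have hε1 : e₁ = -ε := by rw [he₁, hE1, hε, neg_neg]
    have hε2 : e₂ = ε := by rw [he₂, hE2]
    -- (EN): `3ε ≥ S² - ℓ/β'`
    have hEN := dls_bondCorr_energy_bound (2 * k) n hd1 (by omega) hβ'pos
    rw [← hX, ← he₀, ← he₁, ← he₂, hε0, hε1, hε2] at hEN
    have hℓβ' : Real.log (n + 1) / (d * β') = ℓ / β' := by rw [hℓ_def, div_div]
    rw [hℓβ', ← hS_def] at hEN
    -- the β-dependent floor `s_β = S²/3 - ℓ/(3β') ≤ ε`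
    set sβ : ℝ := S ^ 2 / 3 - ℓ / (3 * β') with hsβ_def
    have hℓ3 : ℓ / (3 * β') = ℓ / β' / 3 := by ring
    have hsβε : sβ ≤ ε := by
      rw [hsβ_def, hℓ3]
      linarith only [hEN]
    have hsβle : sβ ≤ S ^ 2 / 3 := by
      have : 0 ≤ ℓ / (3 * β') := by positivity
      linarith only [this, hsβ_def]
    have hsβge : S ^ 2 / 4 ≤ sβ := by linarith only [hℓβ, hm₁le, hsβ_def, sq_nonneg S]
    have hsβ0 : 0 ≤ sβ := le_trans (by positivity) hsβge
    have hεpos : 0 ≤ ε := hsβ0.trans hsβε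
    -- (KLS): `ε ≤ g₀ + ½√(2ε) R + T/(2β')`
    have ht : 0 ≤ e₂ - e₁ := by
      rw [hε1, hε2]
      linarith only [hεpos]
    have h7 := dls_ineq n hd1 hk2 hβ'pos ht
    rw [← hX, ← he₀, ← he₁, ← he₂, ← hg₀, ← hR_def, ← hT_def, hε0, hε1, hε2,
      show ε - -ε = 2 * ε by ring] at h7
    -- the monotone step on `t ↦ t - ½ √t (√2 R)` from `s_β` to `ε`
    have hsqrt2ε : Real.sqrt (2 * ε) = Real.sqrt ε * Real.sqrt 2 := by
      rw [mul_comm, Real.sqrt_mul hεpos]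
    have h2le6 : Real.sqrt 2 ≤ Real.sqrt 6 := Real.sqrt_le_sqrt (by norm_num)
    have hSs : S ≤ 2 * Real.sqrt sβ := by
      have h := Real.sqrt_le_sqrt hsβge
      rw [show S ^ 2 / 4 = (S / 2) ^ 2 by ring, Real.sqrt_sq (by linarith only [hS0])] at h
      linarith only [h]
    have hR4 : Real.sqrt 2 * R ≤ 4 * Real.sqrt sβ :=
      calc Real.sqrt 2 * R ≤ Real.sqrt 2 * ρ' := mul_le_mul_of_nonneg_left hk (Real.sqrt_nonneg _)
        _ ≤ Real.sqrt 6 * ρ' := mul_le_mul_of_nonneg_right h2le6 hρ'0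
        _ ≤ n := hρ'n.le
        _ = 2 * S := by rw [hS_def]; ring
        _ ≤ 4 * Real.sqrt sβ := by linarith only [hSs]
    have hmono := kls_monotone_step (s := sβ) (e := ε) (R := Real.sqrt 2 * R) hsβ0 hsβε hR4
    -- `s_β - ½ √(s_β) (√2 R) ≥ m₁ - ℓ/(3β')`
    have hF : m₁ - ℓ / (3 * β') ≤ sβ - 1 / 2 * Real.sqrt sβ * (Real.sqrt 2 * R) := by
      have h1 : Real.sqrt sβ ≤ Real.sqrt (S ^ 2 / 3) := Real.sqrt_le_sqrt hsβle
      have h2 : Real.sqrt 2 * R ≤ Real.sqrt 2 * ρ' :=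
        mul_le_mul_of_nonneg_left hk (Real.sqrt_nonneg _)
      have hR2 : 0 ≤ Real.sqrt 2 * R := mul_nonneg (Real.sqrt_nonneg _) hR0
      have hc : (0 : ℝ) ≤ 1 / 2 * Real.sqrt (S ^ 2 / 3) :=
        mul_nonneg (by norm_num) (Real.sqrt_nonneg _)
      have h3 : 1 / 2 * Real.sqrt sβ * (Real.sqrt 2 * R) ≤
          1 / 2 * Real.sqrt (S ^ 2 / 3) * (Real.sqrt 2 * ρ') :=
        (mul_le_mul_of_nonneg_right (mul_le_mul_of_nonneg_left h1 (by norm_num)) hR2).trans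
          (mul_le_mul_of_nonneg_left h2 hc)
      linarith only [h3, hm₁_def, hsβ_def]
    -- the thermal term
    have hTβ : 1 / (2 * β') * T ≤ 𝒯 / (2 * β') := by
      rw [one_div_mul_eq_div]
      exact div_le_div_of_nonneg_right hT𝒯 (by positivity)
    -- assemble
    have key : ε - 1 / 2 * Real.sqrt ε * (Real.sqrt 2 * R) - 1 / (2 * β') * T ≤ g₀ := by
      have : 1 / 2 * Real.sqrt (2 * ε) * R = 1 / 2 * Real.sqrt ε * (Real.sqrt 2 * R) := by
        rw [hsqrt2ε]; ring
      linarith only [h7, this]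
    linarith only [key, hmono, hF, hTβ, h𝒯β, hℓβ, hm₁]
  refine lt_of_lt_of_le (by linarith only [hm₁] : (0 : ℝ) < 3 * (m₁ / 2)) ?_
  exact le_liminf_of_le (isCoboundedUnder_ge_of_le atTop fun k => dls_orderParameter_le β n J hd1 k) hev

/-- **Kennedy–Lieb–Shastry (1988), remark p. 1020, at `r = 1`: Néel order at low temperature in
three dimensions for every spin `S ≥ ½`.** For the spin-`S` Heisenberg antiferromagnet
`J Σ_{⟨xy⟩} 𝐒_x·𝐒_y` (`J > 0`, `S = n/2`, `n ≥ 1`) on the even tori `(ℤ/2kℤ)³` there is `β₀ > 0`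
such that for all `β ≥ β₀` the Gibbs states have Néel long-range order
(`HasStaggeredEvenTorusLRO`). The case `S ≥ 1` is Dyson–Lieb–Simon's Theorem 6.2
(`dyson_lieb_simon_holds`); the case `S = ½` is the one DLS left open ("there is a need for better
rigorous bounds to be certain that (62) fails for `ν = 3`, `S = 1/2`") and KLS closed by their
improved integral (here: the certified `klsRiemannSum_three_eventually_le`, `R_L(3) ≤ 2/5 < 1/√6`
eventually). [cite: KLS1988JSP, p. 1020 (remark) and Theorem p. 1022] [cite: DLS1978, Thm. 6.2] -/
theorem kennedy_lieb_shastry_thermal_three {n : ℕ} (hn : 1 ≤ n) {J : ℝ} (hJ : 0 < J) :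
    ∃ β₀ : ℝ, 0 < β₀ ∧ ∀ β : ℝ, β₀ ≤ β →
      HasStaggeredEvenTorusLRO (fun L x y => spinSpinCorrTorus (d := 3) β L n J x y) := by
  obtain ⟨ρ, hρ, hev⟩ := klsRiemannSum_three_eventually_le
  refine heis_thermalNeelOrder_of_riemannSum le_rfl hn ⟨ρ, hρ.trans_le ?_, hev⟩ hJ
  exact div_le_div_of_nonneg_right (by exact_mod_cast hn) (Real.sqrt_nonneg _)

/-- **The spin-½ Heisenberg antiferromagnet on the cubic lattice orders at low temperature**
(`n = 1` in `kennedy_lieb_shastry_thermal_three`): for every `J > 0` there is `β₀ > 0` with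
`liminf_k |Λ|⁻² Σ_{x,y∈(ℤ/2kℤ)³} (-1)^{x+y} ⟨𝐒_x·𝐒_y⟩_{β,2k} > 0` for all `β ≥ β₀`. Together
with `kennedy_lieb_shastry_ground_holds` (ground state, `d = 3`, `S = ½`) and
`mermin_wagner_staggered_holds` (no such order at any `T > 0` in `d ≤ 2`) this is the complete
rigorous picture for `S = ½` next to the open two-dimensional ground-state problem.
[cite: KLS1988JSP, p. 1020 (remark)] [cite: DLS1978, Thm. 6.2] -/
theorem heisenbergAF_spinHalf_cubic_thermalNeelOrder {J : ℝ} (hJ : 0 < J) :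
    ∃ β₀ : ℝ, 0 < β₀ ∧ ∀ β : ℝ, β₀ ≤ β →
      HasStaggeredEvenTorusLRO (fun L x y => spinSpinCorrTorus (d := 3) β L 1 J x y) :=
  kennedy_lieb_shastry_thermal_three le_rfl hJ

end Literature.MathematicalPhysics.QuantumLattice
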